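import Summits.HodgeConjecture.HodgeConjecture.Theorems.HCCMUnconditionalHDelOfFU
import Summits.HodgeConjecture.HodgeConjecture.Theorems.UOfF
import Literature.AlgebraicGeometry.ModuliOfAbelianVarieties.SiegelFineModuliSchemeRelDim
import HarnessLib

/-!
# HC_CM modulo the GENERIC FLOOR — edition FLOOR-G v5 (`hc_cm_of_generic_floor_v5`, E-EQUIDIM currency: (U) DISCHARGED)

B-plan1 (g13) SEQUENCER 2026-08-29T17:17:39Z / 17:20:27Z (director g9 s163–s164, E-EQUIDIM package).  Edition v4 ★ p695965
`hc_cm_of_generic_floor_v4` (`HCCMUnconditionalHDelOfFU.lean`) takes the two generic named facts (F) #63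
`lan2013_siegelFineModuliScheme` and (U) #64 `siegelModuli_complexUniformisation` as hypotheses.  The (U)-lane of the cell has
since PROVED (U) from (F) together with the printed relative dimension `g(g+1)/2` of the Siegel fine moduli scheme
(★ `Theorems.UOfF.U_of_relDim_F`, over the N3-core / P4 / U-a / M13 tree chain), and the relative-dimension clause is carried by
the (F′) edition `lan2013_siegelFineModuliScheme_relDim` of the fact ([Lan2013PELCompactifications] Thm. 1.4.1.11 / Cor. 7.2.3.10 with
Prop. 2.3.5.2; [GortzWedhorn2023] Thm. 27.301 for the numeral), which implies (F) as typed (★ `lan2013_of_relDim`).  This file is the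
one-line re-pointing `hF := lan2013_of_relDim hF′`, `hU := UOfF.U_of_relDim_F hF′`; v1–v4 and the print-exact floor ★
`hc_cm_of_floor_v10` stay intact in their own files.

Main results (namespace `Summit.HodgeConjecture.HodgeConjecture.Theorems`):

* `HDel_of_relDim_F : lan2013_siegelFineModuliScheme_relDim → HCCMUnconditional.HDel` (★ `HDel_of_F_U` ∘ (★ `lan2013_of_relDim`,
  ★ `UOfF.U_of_relDim_F`));
* `hc_cm_of_generic_floor_v5` — hypotheses = EXACTLY SIX: (F′) `hF′`, III-2 (a)′ `hdictE`, III-J3a `hJ3a`, III-2 (c)′ `hocc`, VI-1 `hFal`,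
  III-9′ `h415` (the last five token-identical to v1 / v2 / v3 / v4 / v10) — the GENERIC six-input floor.  Fan A unchanged (item 24835
  `HDel` stays OPEN until (F′) is itself a theorem over Mathlib).

A STATUS theorem, not a discharge: HC_CM is proved only modulo the 7 printed citations until rung 0 closes.
-/

set_option autoImplicit false

-- mandated namespace `Summit.HodgeConjecture.HodgeConjecture.Theorems` trips `linter.dupNamespace` (single-problem summit); off as in
-- `HCCMUnconditionalHDelOfFU.lean` / `…GenericFloorV3.lean`.
set_option linter.dupNamespace false

noncomputable section

namespace Summit.HodgeConjecture.HodgeConjecture.Theorems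

open scoped TensorProduct Matrix
open NumberField NumberField.InfinitePlace IsDedekindDomain
open HodgeCM.Model HodgeCM.Model.LiuIndex HodgeCM.Model.TowerCarrier
open Summit.HodgeConjecture.CorCM.Model
open Literature.AlgebraicGeometry.Motives (CMType AbelianVariety)
open Literature.AlgebraicGeometry.HodgeTheory Literature.NumberTheory.Automorphic.PicardCM
open Literature.AlgebraicGeometry.ShimuraVarieties Literature.AlgebraicGeometry.ShimuraVarieties.UnitaryCanonicalModel
open Literature.NumberTheory.ComplexMultiplication
open Literature.NumberTheory.Automorphic
open Literature.NumberTheory.Automorphic.Liu2021 Literature.NumberTheory.Automorphic.Liu2021.AppendixC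
open Literature.NumberTheory.Automorphic.Liu2021.Def411WeilCarriers (lineOf locF Rep)
open Summit.HodgeConjecture.CorCM.Transposition.OmegaTransport (realUnit)
open HodgeCM.Model.ArchSideTerm (e₁)
open Literature.NumberTheory.GelbartRogawski1991 Literature.NumberTheory.GelbartRogawski1991.UnitaryDualPair
open Literature.RepresentationTheory Literature.RepresentationTheory.Liu2021
open Summit.HodgeConjecture.CorCM
open Summit.HodgeConjecture.CorCM.Transposition
open Literature.NumberTheory.GelbartRogawski1991.OscillatorTripleDictionary (OccursInH1 IsIsoToOmega)
open Summit.HodgeConjecture.CorCM.Lines.A3Liu418 (Thm415AtFace EpsRigidAtFace)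
open Summit.HodgeConjecture.HodgeConjecture.Theses (HCCMUnconditional.HDel)

/-- **`hDel` FROM THE ONE TEXTBOOK FACT (F′)** (B-plan1 (g13) sequencer; director g9 s163–s164): ★ `HDel_of_F_U` with
`hF := lan2013_of_relDim hF′` and `hU := UOfF.U_of_relDim_F hF′` — (U) is a THEOREM of the tree given (F′).
[cite: Lan2013PELCompactifications, Thm. 1.4.1.11 and Cor. 7.2.3.10] [cite: GortzWedhorn2023, Thm. 27.301 (p. 733)]
[cite: MumfordFogartyKirwan1994, Thm. 7.9 and App. 7A] [cite: Deligne1971TravauxShimura, 4.16–4.21 pp. 150–152]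
[cite: Milne2005ShimuraVarieties, Thm. 6.11 and Prop. 14.12 p. 125] -/
theorem HDel_of_relDim_F
    (hF' : Literature.AlgebraicGeometry.ModuliOfAbelianVarieties.lan2013_siegelFineModuliScheme_relDim) :
    Summit.HodgeConjecture.HodgeConjecture.Theses.HCCMUnconditional.HDel :=
  HDel_of_F_U (Literature.AlgebraicGeometry.ModuliOfAbelianVarieties.lan2013_of_relDim hF')
    (UOfF.U_of_relDim_F hF')


set_option synthInstance.maxHeartbeats 400000 in
set_option maxHeartbeats 8000000 in
/-- **GENERIC FLOOR EDITION v5 (E-EQUIDIM currency; B-plan1 (g13) sequencer 2026-08-29T17:17:39Z, director g9 s163–s164)**: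
`hc_cm_of_generic_floor_v4` with its binders (F) #63 `hF` and (U) #64 `hU` discharged by ★ `lan2013_of_relDim hF′` and ★
`UOfF.U_of_relDim_F hF′` from the ONE generic named fact (F′) `hF′ : lan2013_siegelFineModuliScheme_relDim` ([Lan2013PELCompactifications]
1.4.1.11 / 7.2.3.10 + Prop. 2.3.5.2; [GortzWedhorn2023] Thm. 27.301; [MumfordFogartyKirwan1994] Thm. 7.9); one-line body by name, the other five
binders token-identical to v1 / v2 / v3 / v4.  Hypotheses = EXACTLY: (F′) `hF′`, III-2 (a)′ `hdictE`, III-J3a `hJ3a`, III-2 (c)′ `hocc`,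
VI-1 `hFal`, III-9′ `h415` (**6**, generic kind).  A STATUS theorem: HC_CM is proved only modulo the 7 printed citations until rung 0 closes.
[cite: Lan2013PELCompactifications, Thm. 1.4.1.11 and Cor. 7.2.3.10] [cite: GortzWedhorn2023, Thm. 27.301 (p. 733)]
[cite: Deligne1971TravauxShimura, 4.11–4.12, 4.16–4.21 pp. 150–152] [cite: MumfordFogartyKirwan1994, Thm. 7.9 and App. 7A]
[cite: Milne2005ShimuraVarieties, Thm. 6.11; Prop. 14.12 p. 125]
[cite: Liu2021, Thm. 4.18; Prop. 4.13 and its proof l. 2145; Rem. 4.14; Thm. 4.15; App. D Lem. D.1] [cite: GelbartRogawski1991, Thm. 5.1.1 (p. 448); p. 446]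
[cite: Li1992, Thm. 2.1] [cite: Rogawski1990, Thm. 13.3.1] [cite: Shimura1998, Thm. 21.4; Thm. 18.6] [cite: Faltings1983, Satz 4] -/
theorem hc_cm_of_generic_floor_v5
    -- `hDel` ⇐ (F′) via ★ `lan2013_of_relDim`, ★ `UOfF.U_of_relDim_F` and ★ `hc_cm_of_generic_floor_v4`
    (hF' : Literature.AlgebraicGeometry.ModuliOfAbelianVarieties.lan2013_siegelFineModuliScheme_relDim)
    -- `h21` := the closed constant `Theorems.H21_proof` ([Shimura1998] Thm. 21.4 in Serre–Tate currency ⇐ Thm. 18.6 ★ p631138); NO r₀, NO NOS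
    -- `h413` ⇐ rows III-2 (a)′ EXISTENCE, III-J3a, III-2 (c)′ «admissible ⇒ occurs in H¹» at the printed datum (E-III2 R1′, print-exact)
    (hdictE :
      ∀ (hDel : Literature.AlgebraicGeometry.ShimuraVarieties.UnitaryCanonicalModel.canonicalModel_exists_printed)
        (F : HodgeCM.CMField) [IsGalois ℚ F] (h6 : 6 ≤ Module.finrank ℚ F) {ι₁ : F →+* ℂ} (V : HodgeCM.HermSpace3 F ι₁) (a₀ : RealScalar F)
        (Φ : CMType F) (hΦ : ι₁ ∈ Φ.1) (i : (I V (repAt a₀) (muLiu ι₁ GramClass.rep))),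
        oscillatorTriple_dictionaryExistence (((uniformOmegaRep (Summit.HodgeConjecture.CorCM.DelRec.exists_recordSystem_of_printed hDel) ⟨HodgeCM.CMField.K F⟩ ι₁ ⟨HodgeCM.HermSpace3.Hm V, HodgeCM.HermSpace3.isHermitian V, HodgeCM.HermSpace3.signature_ι₁ V, HodgeCM.HermSpace3.posDef_of_ne V⟩ Φ e₁ (frameD V) (frameD_real V) (frameD_ne V) (ιVE V) (2 * imagUnit (HodgeCM.CMField.K F))⁻¹ (fun _ _ => (Rep.update ↥(maximalRealSubfield (HodgeCM.CMField.K F)) (imagUnitSq (HodgeCM.CMField.K F)) (Rep.ofLineOf ↥(maximalRealSubfield (HodgeCM.CMField.K F)) (imagUnitSq (HodgeCM.CMField.K F))) (locF ↥(maximalRealSubfield (HodgeCM.CMField.K F)) (imagUnitSq (HodgeCM.CMField.K F)) (realUnit ⟨HodgeCM.CMField.K F⟩ (repAt a₀ (Sigma.fst i)).1 (repAt a₀ (Sigma.fst i)).2.1 (repAt a₀ (Sigma.fst i)).2.2)) (realUnit ⟨HodgeCM.CMField.K F⟩ (repAt a₀ (Sigma.fst i)).1 (repAt a₀ (Sigma.fst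 i)).2.1 (repAt a₀ (Sigma.fst i)).2.2) rfl)))).prop413Data ((liuDictionaryPin exists_isReal_hodgeModel_holds hodgePQ_independent_of_hodgeModel_holds BallQuotient.ballQuotientUniformised_holds (cmAbelianVarietyRealised_of_eigenbasis exists_isReal_hodgeModel_holds hodgePQ_independent_of_hodgeModel_holds cmAbelianVarietyEigenbasisRealised_holds) Literature.NumberTheory.Transcendental.arapura2012_cor_15_4_6_holds V (I V (repAt a₀) (muLiu ι₁ GramClass.rep)) (line V (repAt a₀) (muLiu ι₁ GramClass.rep)))).H))
    (hJ3a :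
      ∀ (hDel : Literature.AlgebraicGeometry.ShimuraVarieties.UnitaryCanonicalModel.canonicalModel_exists_printed)
        (F : HodgeCM.CMField) [IsGalois ℚ F] (h6 : 6 ≤ Module.finrank ℚ F) {ι₁ : F →+* ℂ} (V : HodgeCM.HermSpace3 F ι₁) (a₀ : RealScalar F)
        (Φ : CMType F) (hΦ : ι₁ ∈ Φ.1) (i : (I V (repAt a₀) (muLiu ι₁ GramClass.rep))),
        (((uniformOmegaRep (Summit.HodgeConjecture.CorCM.DelRec.exists_recordSystem_of_printed hDel) ⟨HodgeCM.CMField.K F⟩ ι₁ ⟨HodgeCM.HermSpace3.Hm V, HodgeCM.HermSpace3.isHermitian V, HodgeCM.HermSpace3.signature_ι₁ V, HodgeCM.HermSpace3.posDef_of_ne V⟩ Φ e₁ (frameD V) (frameD_real V) (frameD_ne V) (ιVE V) (2 * imagUnit (HodgeCM.CMField.K F))⁻¹ (fun _ _ => (Rep.update ↥(maximalRealSubfield (HodgeCM.CMField.K F)) (imagUnitSq (HodgeCM.CMField.K F)) (Rep.ofLineOf ↥(maximalRealSubfield (HodgeCM.CMField.K F)) (imagUnitSq (HodgeCM.CMField.K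 F))) (locF ↥(maximalRealSubfield (HodgeCM.CMField.K F)) (imagUnitSq (HodgeCM.CMField.K F)) (realUnit ⟨HodgeCM.CMField.K F⟩ (repAt a₀ (Sigma.fst i)).1 (repAt a₀ (Sigma.fst i)).2.1 (repAt a₀ (Sigma.fst i)).2.2)) (realUnit ⟨HodgeCM.CMField.K F⟩ (repAt a₀ (Sigma.fst i)).1 (repAt a₀ (Sigma.fst i)).2.1 (repAt a₀ (Sigma.fst i)).2.2) rfl)))).prop413Data ((liuDictionaryPin exists_isReal_hodgeModel_holds hodgePQ_independent_of_hodgeModel_holds BallQuotient.ballQuotientUniformised_holds (cmAbelianVarietyRealised_of_eigenbasis exists_isReal_hodgeModel_holds hodgePQ_independent_of_hodgeModel_holds cmAbelianVarietyEigenbasisRealised_holds) Literature.NumberTheory.Transcendental.arapura2012_cor_15_4_6_holds V (I V (repAt a₀) (muLiu ι₁ GramClass.rep)) (line V (repAt a₀) (muLiu ι₁ GramClass.rep)))).H).multiplicity_le_one_printed)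
    (hocc :
      ∀ (hDel : Literature.AlgebraicGeometry.ShimuraVarieties.UnitaryCanonicalModel.canonicalModel_exists_printed)
        (F : HodgeCM.CMField) [IsGalois ℚ F] (h6 : 6 ≤ Module.finrank ℚ F) {ι₁ : F →+* ℂ} (V : HodgeCM.HermSpace3 F ι₁) (a₀ : RealScalar F)
        (Φ : CMType F) (hΦ : ι₁ ∈ Φ.1) (i : (I V (repAt a₀) (muLiu ι₁ GramClass.rep))),
        admissible_occursInH1 (((uniformOmegaRep (Summit.HodgeConjecture.CorCM.DelRec.exists_recordSystem_of_printed hDel) ⟨HodgeCM.CMField.K F⟩ ι₁ ⟨HodgeCM.HermSpace3.Hm V, HodgeCM.HermSpace3.isHermitian V, HodgeCM.HermSpace3.signature_ι₁ V, HodgeCM.HermSpace3.posDef_of_ne V⟩ Φ e₁ (frameD V) (frameD_real V) (frameD_ne V) (ιVE V) (2 * imagUnit (HodgeCM.CMField.K F))⁻¹ (fun _ _ => (Rep.update ↥(maximalRealSubfield (HodgeCM.CMField.K F)) (imagUnitSq (HodgeCM.CMField.K F)) (Rep.ofLineOf ↥(maximalRealSubfield (HodgeCM.CMField.K F)) (imagUnitSq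 (HodgeCM.CMField.K F))) (locF ↥(maximalRealSubfield (HodgeCM.CMField.K F)) (imagUnitSq (HodgeCM.CMField.K F)) (realUnit ⟨HodgeCM.CMField.K F⟩ (repAt a₀ (Sigma.fst i)).1 (repAt a₀ (Sigma.fst i)).2.1 (repAt a₀ (Sigma.fst i)).2.2)) (realUnit ⟨HodgeCM.CMField.K F⟩ (repAt a₀ (Sigma.fst i)).1 (repAt a₀ (Sigma.fst i)).2.1 (repAt a₀ (Sigma.fst i)).2.2) rfl)))).prop413Data ((liuDictionaryPin exists_isReal_hodgeModel_holds hodgePQ_independent_of_hodgeModel_holds BallQuotient.ballQuotientUniformised_holds (cmAbelianVarietyRealised_of_eigenbasis exists_isReal_hodgeModel_holds hodgePQ_independent_of_hodgeModel_holds cmAbelianVarietyEigenbasisRealised_holds) Literature.NumberTheory.Transcendental.arapura2012_cor_15_4_6_holds V (I V (repAt a₀) (muLiu ι₁ GramClass.rep)) (line V (repAt a₀) (muLiu ι₁ GramClass.rep)))).H))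
    -- `hLiu418` ⇐ rows VI-1, III-9′ (III-0 Liu Lem. 2.4 (1) and III-11 by their CLOSED tree terms)
    (hFal : ∀ {K : Type} [Field K] (A B : AbelianVariety K) (ℓ : ℕ) [Fact ℓ.Prime], Literature.AlgebraicGeometry.Motives.faltings_tate_bijective A B ℓ)
    (h415 : Thm415AtFace) :
    Summit.HodgeConjecture.HodgeConjecture.Theses.RankFourFaces.CMAbelianHodge :=
  hc_cm_of_generic_floor_v4 (Literature.AlgebraicGeometry.ModuliOfAbelianVarieties.lan2013_of_relDim hF')
    (UOfF.U_of_relDim_F hF') hdictE hJ3a hocc hFal h415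

end Summit.HodgeConjecture.HodgeConjecture.Theorems

end
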